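import Mathlib.Analysis.InnerProductSpace.PiL2
import Mathlib.Analysis.Matrix.Normed
import Mathlib.LinearAlgebra.Matrix.Trace
import Mathlib.LinearAlgebra.UnitaryGroup
import Mathlib.LinearAlgebra.Matrix.ToLin
import Mathlib.Analysis.Normed.Operator.Basic
import Mathlib.Topology.Algebra.Module.FiniteDimension
import Mathlib.Algebra.Order.Chebyshev
import HarnessLib

/-!
# The Frobenius inner product on complex matrices, traces and unitary values (folklore; proved)

Everything in this file is PROVED (plus one definition: the inner-product structure). C. Müllner,
*Automatic sequences fulfill the Sarnak conjecture*, Duke Math. J. 166 (2017), §4–5, runs the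
Mauduit–Rivat machinery for functions `f : ℕ → U_d` (unitary `d × d` matrices) with the
FROBENIUS norm `‖·‖_F`, and repeatedly uses (§5.4): `|tr A| ≤ √d ‖A‖_F`, the cyclicity of the
trace ("by well-known properties of the trace we can exchange the order of the matrices"), the
Cauchy–Schwarz inequality for `⟨A, B⟩ = tr(Aᴴ B)`, and `‖A U‖_F = ‖A‖_F` for unitary `U`. The
tree's Mauduit–Rivat lemma files (`MauduitRivatVanDerCorput*`, `MauduitRivatLargeSieve`, …) are
stated for sequences with values in a complex inner product space; to use them for matrices one
needs an `InnerProductSpace ℂ (Matrix m n ℂ)` structure compatible with Mathlib's (scoped)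
Frobenius norm `Matrix.Norms.Frobenius`, which Mathlib does not provide. This file supplies it:

* `frobeniusInnerProductSpace` — `⟪A, B⟫ = ∑_{i,j} conj(A i j) B i j` on `Matrix m n ℂ`, an
  `InnerProductSpace ℂ` structure whose norm IS the Frobenius norm (a `scoped instance` in the
  namespace `Literature.NumberTheory.LFunctions.MauduitRivat`; open that namespace together with
  `open scoped Matrix.Norms.Frobenius`);
* `inner_eq_trace` — `⟪A, B⟫ = tr(Aᴴ B)`; `norm_sq_eq_re_trace`;
* `norm_trace_le` — `‖tr A‖ ≤ √(card n) ‖A‖`; `norm_trace_mul_le` — `‖tr(A B)‖ ≤ ‖A‖ ‖B‖`;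
* `norm_coe_unitary` — `‖U‖ = √(card n)` for `U` unitary; `norm_mul_unitary`, `norm_unitary_mul` —
  `‖A U‖ = ‖A‖ = ‖U A‖`; `coe_inv_unitary` — `↑U⁻¹ = (↑U)ᴴ`;
* the dictionary with OPERATORS on a finite-dimensional inner-product space `W` in an orthonormal
  basis `b` (`d = |ι|`): `toMatrix_orthonormalBasis_apply` (`[T]_b i j = ⟨b i, T b j⟩`),
  `frobenius_norm_sq_toMatrix` (`‖[T]_b‖² = ∑_j ‖T b_j‖²`), `opNorm_le_frobenius_norm_toMatrix`
  (`‖T‖_op ≤ ‖[T]_b‖_F`), `frobenius_norm_toMatrix_le` (`‖[T]_b‖_F ≤ √d ‖T‖_op`),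
  `toMatrix_mem_unitaryGroup` (an isometry has a unitary matrix) and `unitaryMatrixHom` (an
  isometric representation `G →* (W →ₗ W)` gives `G →* unitaryGroup ι ℂ`).

## References
* C. Müllner, Duke Math. J. 166 (2017) = arXiv:1602.03042, §4 (p. 19: `f : ℕ → U_d`, `‖·‖_F`)
  and §5.4 (p. 26–27: "`|tr(A)| ≤ ‖A‖_F √d`", "exchange the order of the matrices").
  [Mullner2017]
-/

noncomputable section

open Finset Matrix
open scoped InnerProductSpace Matrix.Norms.Frobenius ComplexConjugate

namespace Literature.NumberTheory.LFunctions.MauduitRivat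

section Inner

variable {m n p : Type*} [Fintype m] [Fintype n] [Fintype p]

/-- **The Frobenius inner product** `⟪A, B⟫ = ∑_{i,j} conj(A i j) · B i j` on `Matrix m n ℂ`, as an
`InnerProductSpace ℂ` structure over Mathlib's Frobenius norm (`Matrix.frobeniusNormedSpace`).
[folklore] -/
@[instance_reducible]
def frobeniusInnerProductSpace : InnerProductSpace ℂ (Matrix m n ℂ) :=
  { Matrix.frobeniusNormedSpace with
    inner := fun A B => ∑ i, ∑ j, conj (A i j) * B i j
    norm_sq_eq_re_inner := fun A => by
      rw [Matrix.frobenius_norm_def, ← Real.sqrt_eq_rpow, Real.sq_sqrt (by positivity), map_sum]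
      refine sum_congr rfl fun i _ => ?_
      rw [map_sum]
      refine sum_congr rfl fun j _ => ?_
      rw [RCLike.conj_mul, Real.rpow_two, ← RCLike.ofReal_pow, RCLike.ofReal_re]
    conj_inner_symm := fun A B => by
      simp only [map_sum, map_mul, Complex.conj_conj]
      exact sum_congr rfl fun i _ => sum_congr rfl fun j _ => mul_comm _ _
    add_left := fun A B C => by
      simp only [Matrix.add_apply, map_add, add_mul, sum_add_distrib]
    smul_left := fun A B r => by
      simp only [Matrix.smul_apply, smul_eq_mul, map_mul, mul_assoc, mul_sum] }

attribute [scoped instance] frobeniusInnerProductSpace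

/-- Unfolding the Frobenius inner product. [folklore] -/
theorem inner_def (A B : Matrix m n ℂ) : ⟪A, B⟫_ℂ = ∑ i, ∑ j, conj (A i j) * B i j := rfl

/-- **`⟪A, B⟫ = tr(Aᴴ B)`.** [folklore] -/
theorem inner_eq_trace (A B : Matrix m n ℂ) : ⟪A, B⟫_ℂ = trace (Aᴴ * B) := by
  rw [inner_def, Matrix.trace, sum_comm]
  refine sum_congr rfl fun j _ => ?_
  simp only [Matrix.diag_apply, Matrix.mul_apply, Matrix.conjTranspose_apply, starRingEnd_apply]

/-- `‖A‖² = re tr(Aᴴ A)`. [folklore] -/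
theorem norm_sq_eq_re_trace (A : Matrix m n ℂ) : ‖A‖ ^ 2 = (trace (Aᴴ * A)).re := by
  rw [← inner_eq_trace]
  exact norm_sq_eq_re_inner (𝕜 := ℂ) A

/-- **`‖tr(A B)‖ ≤ ‖A‖ ‖B‖`** (Cauchy–Schwarz for `tr(A B) = ⟪Aᴴ, B⟫`). [folklore] -/
theorem norm_trace_mul_le (A : Matrix m n ℂ) (B : Matrix n m ℂ) : ‖trace (A * B)‖ ≤ ‖A‖ * ‖B‖ := by
  have h : trace (A * B) = ⟪Aᴴ, B⟫_ℂ := by rw [inner_eq_trace, conjTranspose_conjTranspose]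
  rw [h, ← Matrix.frobenius_norm_conjTranspose A]
  exact norm_inner_le_norm _ _

variable [DecidableEq n]

/-- `‖1‖ = √(card n)` for the Frobenius norm. [folklore] -/
theorem frobenius_norm_one : ‖(1 : Matrix n n ℂ)‖ = Real.sqrt (Fintype.card n) := by
  have h : ‖(1 : Matrix n n ℂ)‖ ^ 2 = Fintype.card n := by
    rw [norm_sq_eq_re_trace, conjTranspose_one, one_mul, trace_one]
    simp
  rw [← h, Real.sqrt_sq (norm_nonneg _)]

/-- **`‖tr A‖ ≤ √(card n) · ‖A‖`** (Müllner: "`|tr(A)| ≤ ‖A‖_F √d`").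
[cite: Mullner2017, §5.4 (p. 27)] -/
theorem norm_trace_le (A : Matrix n n ℂ) : ‖trace A‖ ≤ Real.sqrt (Fintype.card n) * ‖A‖ := by
  have h := norm_trace_mul_le (1 : Matrix n n ℂ) A
  rwa [one_mul, frobenius_norm_one] at h

/-- For a unitary matrix, `↑U⁻¹ = (↑U)ᴴ`. [folklore] -/
theorem coe_inv_unitary (U : unitaryGroup n ℂ) : ((U⁻¹ : unitaryGroup n ℂ) : Matrix n n ℂ) = (U : Matrix n n ℂ)ᴴ := by
  rw [← Unitary.star_eq_inv, Unitary.coe_star, star_eq_conjTranspose]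

/-- `Uᴴ U = 1` for `U` unitary. [folklore] -/
theorem conjTranspose_mul_self_unitary (U : unitaryGroup n ℂ) :
    (U : Matrix n n ℂ)ᴴ * (U : Matrix n n ℂ) = 1 := by
  rw [← star_eq_conjTranspose]; exact Unitary.coe_star_mul_self U

/-- `U Uᴴ = 1` for `U` unitary. [folklore] -/
theorem mul_conjTranspose_self_unitary (U : unitaryGroup n ℂ) :
    (U : Matrix n n ℂ) * (U : Matrix n n ℂ)ᴴ = 1 := by
  rw [← star_eq_conjTranspose]; exact Unitary.coe_mul_star_self U

/-- **A unitary matrix has Frobenius norm `√(card n)`.** [cite: Mullner2017, §5.4] -/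
theorem norm_coe_unitary (U : unitaryGroup n ℂ) : ‖(U : Matrix n n ℂ)‖ = Real.sqrt (Fintype.card n) := by
  have h : ‖(U : Matrix n n ℂ)‖ ^ 2 = Fintype.card n := by
    rw [norm_sq_eq_re_trace, conjTranspose_mul_self_unitary, trace_one]
    simp
  rw [← h, Real.sqrt_sq (norm_nonneg _)]

/-- **`‖A U‖ = ‖A‖` for `U` unitary.** [folklore] -/
theorem norm_mul_unitary (A : Matrix m n ℂ) (U : unitaryGroup n ℂ) : ‖A * (U : Matrix n n ℂ)‖ = ‖A‖ := by
  have h : ‖A * (U : Matrix n n ℂ)‖ ^ 2 = ‖A‖ ^ 2 := by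
    rw [norm_sq_eq_re_trace, norm_sq_eq_re_trace, conjTranspose_mul, Matrix.mul_assoc,
      trace_mul_comm, Matrix.mul_assoc, Matrix.mul_assoc, mul_conjTranspose_self_unitary, Matrix.mul_one]
  have := (sq_eq_sq₀ (norm_nonneg _) (norm_nonneg _)).1 h
  exact this

omit [DecidableEq n] in
/-- **`‖U A‖ = ‖A‖` for `U` unitary.** [folklore] -/
theorem norm_unitary_mul [DecidableEq m] (U : unitaryGroup m ℂ) (A : Matrix m n ℂ) :
    ‖(U : Matrix m m ℂ) * A‖ = ‖A‖ := by
  have h : ‖(U : Matrix m m ℂ) * A‖ ^ 2 = ‖A‖ ^ 2 := by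
    rw [norm_sq_eq_re_trace, norm_sq_eq_re_trace, conjTranspose_mul, Matrix.mul_assoc,
      ← Matrix.mul_assoc ((U : Matrix m m ℂ)ᴴ), conjTranspose_mul_self_unitary, Matrix.one_mul]
  exact (sq_eq_sq₀ (norm_nonneg _) (norm_nonneg _)).1 h

/-- For a unitary-valued homomorphism, `D(x) D(y)ᴴ = D(x y⁻¹)` as matrices. [folklore] -/
theorem coe_map_mul_conjTranspose {G : Type*} [Group G] (D : G →* unitaryGroup n ℂ) (x y : G) :
    (D x : Matrix n n ℂ) * (D y : Matrix n n ℂ)ᴴ = (D (x * y⁻¹) : Matrix n n ℂ) := by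
  rw [map_mul, map_inv, Submonoid.coe_mul, coe_inv_unitary]

/-- For a unitary-valued homomorphism, `D(x)ᴴ D(y) = D(x⁻¹ y)` as matrices. [folklore] -/
theorem conjTranspose_coe_map_mul {G : Type*} [Group G] (D : G →* unitaryGroup n ℂ) (x y : G) :
    (D x : Matrix n n ℂ)ᴴ * (D y : Matrix n n ℂ) = (D (x⁻¹ * y) : Matrix n n ℂ) := by
  rw [map_mul, map_inv, Submonoid.coe_mul, coe_inv_unitary]

/-- The trace is invariant under unitary conjugation: `tr(U A Uᴴ) = tr A`. [folklore] -/
theorem trace_unitary_conj (U : unitaryGroup n ℂ) (A : Matrix n n ℂ) :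
    trace ((U : Matrix n n ℂ) * A * (U : Matrix n n ℂ)ᴴ) = trace A := by
  rw [trace_mul_cycle, conjTranspose_mul_self_unitary, Matrix.one_mul]

end Inner

/-! ## Operators on a finite-dimensional inner-product space as matrices -/

section Operators

variable {ι : Type*} [Fintype ι] [DecidableEq ι]
variable {W : Type*} [NormedAddCommGroup W] [InnerProductSpace ℂ W]

/-- Matrix entries in an orthonormal basis: `[T]_b i j = ⟨b i, T (b j)⟩`. [folklore] -/
theorem toMatrix_orthonormalBasis_apply (b : OrthonormalBasis ι ℂ W) (T : W →ₗ[ℂ] W) (i j : ι) :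
    LinearMap.toMatrix b.toBasis b.toBasis T i j = ⟪b i, T (b j)⟫_ℂ := by
  rw [LinearMap.toMatrix_apply, OrthonormalBasis.coe_toBasis_repr_apply,
    OrthonormalBasis.repr_apply_apply, OrthonormalBasis.coe_toBasis]

/-- **`‖[T]_b‖_F² = ∑_j ‖T (b j)‖²`** (Parseval in each column). [folklore] -/
theorem frobenius_norm_sq_toMatrix (b : OrthonormalBasis ι ℂ W) (T : W →ₗ[ℂ] W) :
    ‖LinearMap.toMatrix b.toBasis b.toBasis T‖ ^ 2 = ∑ j, ‖T (b j)‖ ^ 2 := by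
  rw [Matrix.frobenius_norm_def, ← Real.sqrt_eq_rpow, Real.sq_sqrt (by positivity)]
  simp_rw [Real.rpow_two, toMatrix_orthonormalBasis_apply]
  rw [sum_comm]
  exact sum_congr rfl fun j _ => b.sum_sq_norm_inner_right (T (b j))

/-- **`‖T‖_op ≤ ‖[T]_b‖_F`** (expand in the basis and use Cauchy–Schwarz). [folklore] -/
theorem opNorm_le_frobenius_norm_toMatrix [FiniteDimensional ℂ W] (b : OrthonormalBasis ι ℂ W)
    (T : W →ₗ[ℂ] W) :
    ‖LinearMap.toContinuousLinearMap T‖ ≤ ‖LinearMap.toMatrix b.toBasis b.toBasis T‖ := by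
  refine ContinuousLinearMap.opNorm_le_bound _ (norm_nonneg _) fun v => ?_
  rw [LinearMap.coe_toContinuousLinearMap']
  have hv : T v = ∑ j, ⟪b j, v⟫_ℂ • T (b j) := by
    conv_lhs => rw [← b.sum_repr' v]
    rw [map_sum]
    exact sum_congr rfl fun j _ => by rw [map_smul]
  rw [hv]
  calc ‖∑ j, ⟪b j, v⟫_ℂ • T (b j)‖ ≤ ∑ j, ‖⟪b j, v⟫_ℂ‖ * ‖T (b j)‖ :=
        (norm_sum_le _ _).trans (le_of_eq (sum_congr rfl fun j _ => norm_smul _ _))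
    _ ≤ Real.sqrt (∑ j, ‖⟪b j, v⟫_ℂ‖ ^ 2) * Real.sqrt (∑ j, ‖T (b j)‖ ^ 2) :=
        Real.sum_mul_le_sqrt_mul_sqrt _ _ _
    _ = ‖LinearMap.toMatrix b.toBasis b.toBasis T‖ * ‖v‖ := by
        rw [b.sum_sq_norm_inner_right v, Real.sqrt_sq (norm_nonneg _), ← frobenius_norm_sq_toMatrix,
          Real.sqrt_sq (norm_nonneg _), mul_comm]

/-- **`‖[T]_b‖_F ≤ √d ‖T‖_op`** (`d = |ι|`). [folklore] -/
theorem frobenius_norm_toMatrix_le [FiniteDimensional ℂ W] (b : OrthonormalBasis ι ℂ W) (T : W →ₗ[ℂ] W) :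
    ‖LinearMap.toMatrix b.toBasis b.toBasis T‖ ≤
      Real.sqrt (Fintype.card ι) * ‖LinearMap.toContinuousLinearMap T‖ := by
  have hsq : ‖LinearMap.toMatrix b.toBasis b.toBasis T‖ ^ 2 ≤
      (Fintype.card ι : ℝ) * ‖LinearMap.toContinuousLinearMap T‖ ^ 2 := by
    rw [frobenius_norm_sq_toMatrix]
    calc ∑ j, ‖T (b j)‖ ^ 2 ≤ ∑ _j : ι, ‖LinearMap.toContinuousLinearMap T‖ ^ 2 := by
          refine sum_le_sum fun j _ => ?_
          have h := (LinearMap.toContinuousLinearMap T).le_opNorm (b j)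
          rw [LinearMap.coe_toContinuousLinearMap', b.orthonormal.1 j, mul_one] at h
          exact pow_le_pow_left₀ (norm_nonneg _) h 2
      _ = (Fintype.card ι : ℝ) * ‖LinearMap.toContinuousLinearMap T‖ ^ 2 := by
          rw [sum_const, card_univ, nsmul_eq_mul]
  calc ‖LinearMap.toMatrix b.toBasis b.toBasis T‖
      = Real.sqrt (‖LinearMap.toMatrix b.toBasis b.toBasis T‖ ^ 2) := (Real.sqrt_sq (norm_nonneg _)).symm
    _ ≤ Real.sqrt ((Fintype.card ι : ℝ) * ‖LinearMap.toContinuousLinearMap T‖ ^ 2) :=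
        Real.sqrt_le_sqrt hsq
    _ = Real.sqrt (Fintype.card ι) * ‖LinearMap.toContinuousLinearMap T‖ := by
        rw [Real.sqrt_mul (Nat.cast_nonneg _), Real.sqrt_sq (norm_nonneg _)]

/-- **An isometry has a unitary matrix** in an orthonormal basis. [folklore] -/
theorem toMatrix_mem_unitaryGroup (b : OrthonormalBasis ι ℂ W) {T : W →ₗ[ℂ] W}
    (hT : ∀ w, ‖T w‖ = ‖w‖) : LinearMap.toMatrix b.toBasis b.toBasis T ∈ unitaryGroup ι ℂ := by
  -- the linear isometry
  set L : W →ₗᵢ[ℂ] W := { toLinearMap := T, norm_map' := hT } with hL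
  have hLT : ∀ w, L w = T w := fun w => rfl
  rw [mem_unitaryGroup_iff', star_eq_conjTranspose]
  ext i j
  rw [Matrix.mul_apply, Matrix.one_apply]
  simp_rw [Matrix.conjTranspose_apply, toMatrix_orthonormalBasis_apply, ← hLT]
  -- `∑_l conj ⟨b l, L b_i⟩ ⟨b l, L b_j⟩ = ⟨L b_i, L b_j⟩ = ⟨b_i, b_j⟩`
  have key : ∑ l, star ⟪b l, L (b i)⟫_ℂ * ⟪b l, L (b j)⟫_ℂ = ⟪L (b i), L (b j)⟫_ℂ := by
    rw [← b.sum_inner_mul_inner (L (b i)) (L (b j))]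
    refine sum_congr rfl fun l _ => ?_
    rw [← inner_conj_symm (L (b i)) (b l)]
    rfl
  rw [key, LinearIsometry.inner_map_map, orthonormal_iff_ite.1 b.orthonormal]

/-- The unitary-matrix form of an isometric representation `U : G →* (W →ₗ W)` in an orthonormal
basis: `g ↦ [U g]_b` as a homomorphism into `unitaryGroup ι ℂ`. [folklore] -/
def unitaryMatrixHom {G : Type*} [Group G] (b : OrthonormalBasis ι ℂ W) (U : G →* (W →ₗ[ℂ] W))
    (hU : ∀ g w, ‖U g w‖ = ‖w‖) : G →* unitaryGroup ι ℂ :=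
  MonoidHom.codRestrict ((LinearMap.toMatrixAlgEquiv b.toBasis : (W →ₗ[ℂ] W) ≃ₐ[ℂ] Matrix ι ι ℂ).toMonoidHom.comp U)
    (unitaryGroup ι ℂ) fun g => toMatrix_mem_unitaryGroup b (hU g)

/-- Unfolding `unitaryMatrixHom`: its value at `g` is the matrix of `U g`. [folklore] -/
theorem coe_unitaryMatrixHom {G : Type*} [Group G] (b : OrthonormalBasis ι ℂ W) (U : G →* (W →ₗ[ℂ] W))
    (hU : ∀ g w, ‖U g w‖ = ‖w‖) (g : G) :
    (unitaryMatrixHom b U hU g : Matrix ι ι ℂ) = LinearMap.toMatrix b.toBasis b.toBasis (U g) := rfl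

/-- `toMatrix` of a finite linear combination of operators, applied through
`LinearMap.toContinuousLinearMap`: the matrix of `∑ c_n • T_n` is `∑ c_n • [T_n]`. [folklore] -/
theorem toMatrix_sum_smul (b : OrthonormalBasis ι ℂ W) (s : Finset ℕ) (c : ℕ → ℂ) (T : ℕ → W →ₗ[ℂ] W) :
    LinearMap.toMatrix b.toBasis b.toBasis (∑ n ∈ s, c n • T n) =
      ∑ n ∈ s, c n • LinearMap.toMatrix b.toBasis b.toBasis (T n) := by
  rw [map_sum]
  exact sum_congr rfl fun n _ => by rw [LinearEquiv.map_smul]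

end Operators

end Literature.NumberTheory.LFunctions.MauduitRivat
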